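import Literature.Geometry.Riemannian.MetricFlowFLimitPairAux4
import Literature.Geometry.Riemannian.MetricFlowFLimitPairAux5
import HarnessLib

/-!
# The limit metric flow pair of a fast `𝔽`-Cauchy chain within a correspondence
# (Bamler 2023, §5.4, Lemma 5.20 — construction of the limit)

R. Bamler, *Compactness theory of the space of super Ricci flows*, Invent. Math. 233 (2023), §5.4,
Lemma 5.20 (arXiv v1 Lemma 121): *"Let `(𝒳ⁱ, (μⁱ_t)_{t ∈ I'^{,i}})`, `i ∈ ℕ`, be a sequence of
metric flow pairs over `I` that are fully defined over `J`. Consider a correspondence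
`ℭ := ((Z_t, d^Z_t)_{t ∈ I}, (φⁱ_t)_{t ∈ I''^{,i}, i ∈ ℕ})` between the metric flows `𝒳ⁱ` over `I`
that is also fully defined over `J` and suppose that the metric spaces `(Z_t, d^Z_t)_{t ∈ I}` are
complete. Suppose that the metric flow pairs `(𝒳ⁱ, (μⁱ_t)_{t ∈ I'^{,i}})` form a Cauchy sequence
within `ℭ` that is uniform over `J` … Then there is a metric flow pair
`(𝒳^∞, (μ^∞_t)_{t ∈ I'^{,∞}})` over `I` that is fully defined over `J` and a family of isometric
embeddings `(φ^∞_t : 𝒳^∞_t → Z_t)_{t ∈ I''^{,∞}}`, `I''^{,∞} ⊂ I` such that `ℭ' := ((Z_t, d^Z_t),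
(φⁱ_t)_{t ∈ I''^{,i}, i ∈ ℕ ∪ {∞}})` is a correspondence between all metric flows `𝒳ⁱ`,
`i ∈ ℕ ∪ {∞}`, and such that we have convergence
`d^{ℭ',J}_𝔽((𝒳ⁱ, (μⁱ_t)), (𝒳^∞, (μ^∞_t))) → 0`."*

This file completes the CONSTRUCTION half of the printed proof (p. 42–43 of arXiv v1: the good
times `I ∖ E^∞`, the limit measures `μ^∞_t`, the limit slices `X^∞_t := supp μ^∞_t`, Claim 5.21 —
the limit kernels `ν^∞_{x;s}` — and Claim 5.22 — `(𝒳^∞, (μ^∞_t))` is a metric flow pair), assembled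
in `MetricFlowFLimitPairAux1–5.lean` for a FAST chain (admissible radii `2^{-n}` with exceptional
sets `E n`, the reduction made at the start of the printed proof), and packages it:

* `ChainSetup.limitFlow`, `ChainSetup.limitPair` — the limit metric flow `𝒳^∞` over
  `I'^{,∞} = I₀ ∖ ⋂ᵢ ⋃ₖ E (i + k)` and the limit metric flow pair `(𝒳^∞, (μ^∞_t))` over `I₀`
  (Def. 3.2 (1)–(7), Def. 5.1: `|I₀ ∖ I'^{,∞}| = 0`, conjugate heat flow of full support), with
  `ChainSetup.isHConcentrated_limitFlow` (the limit of `H`-concentrated flows is `H`-concentrated,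
  as in §7.3);
* `MetricFlowPair.exists_limitPair_of_chain` — **the statement consumed by the convergence half of
  Lemma 5.20 in the tree**: existence of the limit pair `P∞` over `I₀` with
  `I₀ ∖ ⋃ₖ E (i + k) ⊆ I'^{,∞}` for all `i`, isometric embeddings `ι_t : 𝒳^∞_t → Z_t` (the
  inclusions), `H`-concentration, `I₀ ∖ I'^{,∞} = ⋂ᵢ ⋃ₖ E (i + k)` measurable, and the three
  convergence properties: `d_{W₁}((φ^{i+k}_t)_* μ^{i+k}_t, (ι_t)_* μ^∞_t) < 4 · 2^{-(i+k)}` at the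
  good times of stage `i`, every point of `𝒳^∞_t` is a limit of images `φ^{i+k}_t(x_k)`, and
  `(φ^{i+k}_s)_* ν^{i+k}_{x_k;s} → (ι_s)_* ν^∞_{z;s}` in `d_{W₁}` along every such sequence
  (Claim 5.21).

## References

* R. H. Bamler, *Compactness theory of the space of super Ricci flows*, Invent. Math. 233 (2023),
  1121–1277 (arXiv:2008.09298), §5.4, Lemma 5.20 and Claims 5.21–5.22 in its proof (arXiv v1
  Lemma 121, Claims 122–123); §3.1, Def. 3.2; §5.1, Def. 5.1. [Bamler2023]
-/

noncomputable section

open Set MeasureTheory Filter TopologicalSpace Function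
open scoped Topology ENNReal NNReal

namespace Literature.Geometry.Riemannian

universe u

namespace MetricFlowPair

open MetricFlow

namespace ChainSetup

variable {I₀ : Set ℝ} (S : ChainSetup.{u} I₀)

/-- **The limit metric flow `𝒳^∞` over `I'^{,∞} = I₀ ∖ E^∞`** (Bamler 2023, Claim 5.22): time-slices
`X^∞_t = supp μ^∞_t ⊆ Z_t` with the induced metrics (complete, separable), conjugate heat kernels
`ν^∞_{x;s}` (Claim 5.21, pulled back to `X^∞_s`), which are probability measures for `s ≤ t` with
`ν^∞_{x;t} = δ_x`, satisfy the gradient property (6) (`gradient_property_limit`) and the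
reproduction formula (7) (`reproduction_limit`).
[cite: Bamler2023, §5.4, Lemma 5.20, Claim 5.22 (arXiv v1 Claim 123)] -/
def limitFlow : MetricFlow.{u} S.I' where
  Slice t := S.X t t.2
  condKernel x s := S.kernel _ x s.2
  isProbabilityMeasure_condKernel x _ hst := S.isProbabilityMeasure_kernel _ _ hst x
  condKernel_self x := S.kernel_self _ x
  gradient_property hst T hT u hu h01 hLip := S.gradient_property_limit _ _ hst T hT u hu h01 hLip
  reproduction h12 h23 x A hA := S.reproduction_limit _ _ _ h12 h23 x A hA

/-- **The limit flow is `H`-concentrated** (`variance_kernel_le`).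
[cite: Bamler2023, §3.4, Definition (H-concentration); §7.3 (arXiv v1 Lemma 166), proof] -/
theorem isHConcentrated_limitFlow : S.limitFlow.IsHConcentrated S.H :=
  fun s t hst x₁ x₂ ↦ S.variance_kernel_le s.2 t.2 hst x₁ x₂

/-- **The limit metric flow pair `(𝒳^∞, (μ^∞_t)_{t ∈ I'^{,∞}})` over `I₀`** (Bamler 2023, Claim
5.22): `I'^{,∞} = I₀ ∖ E^∞` has full measure (`|E^∞| = 0`), `μ^∞_t` restricted to its support
`X^∞_t` is a probability measure of full support, and `(μ^∞_t)` is a conjugate heat flow on `𝒳^∞`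
(`supportMeasure_m_apply`). [cite: Bamler2023, §5.4, Lemma 5.20, Claim 5.22 (arXiv v1 Claim 123)] -/
def limitPair : MetricFlowPair.{u} I₀ where
  I' := S.I'
  subset := S.I'_subset
  volume_diff := by rw [S.diff_I']; exact S.volume_N
  flow := S.limitFlow
  μ t := supportMeasure (S.m t t.2)
  isConjugateHeatFlow :=
    ⟨fun t _ ↦ isProbabilityMeasure_supportMeasure (S.m t t.2),
      fun s t _ _ hst A hA ↦ S.supportMeasure_m_apply s.2 t.2 hst A hA⟩
  isOpenPosMeasure t := isOpenPosMeasure_supportMeasure (S.m t t.2)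

/-- **Lemma 5.20, construction, for the bundled chain**: the limit pair `S.limitPair`, the
inclusions `ι_t : X^∞_t → Z_t` and the convergence properties (`wassersteinW1_push_m_le`,
`exists_seq_tendsto`, `tendsto_kpush_νZ`).
[cite: Bamler2023, §5.4, Lemma 5.20 (arXiv v1 Lemma 121), Claims 5.21–5.22] -/
theorem exists_limitPair :
    ∃ (Pinf : MetricFlowPair.{u} I₀) (hI' : ∀ i, I₀ \ ⋃ k, S.E (i + k) ⊆ Pinf.I')
      (ι : ∀ (t : ℝ) (ht : t ∈ Pinf.I'), Pinf.flow.Slice ⟨t, ht⟩ → S.ℭ.Z ⟨t, Pinf.subset ht⟩),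
      (∀ t ht, Isometry (ι t ht)) ∧ Pinf.flow.IsHConcentrated S.H ∧
      I₀ \ Pinf.I' = ⋂ i, ⋃ k, S.E (i + k) ∧ MeasurableSet (I₀ \ Pinf.I') ∧
      (∀ i k t (ht : t ∈ I₀ \ ⋃ k, S.E (i + k)),
        wassersteinW1 (X := S.ℭ.Z ⟨t, ht.1⟩)
          (((S.P (i + k)).μ ⟨t, (S.ℭ.dom_subset (i + k)
              (S.hdom₁ (i + k) ⟨ht.1, fun h ↦ ht.2 (mem_iUnion.2 ⟨k, h⟩)⟩)).1⟩).map
            (S.ℭ.φ (i + k) t (S.hdom₁ (i + k) ⟨ht.1, fun h ↦ ht.2 (mem_iUnion.2 ⟨k, h⟩)⟩)))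
          ((Pinf.μ ⟨t, hI' i ht⟩).map (ι t (hI' i ht))) < ENNReal.ofReal (4 * 2⁻¹ ^ (i + k))) ∧
      (∀ i t (ht : t ∈ I₀ \ ⋃ k, S.E (i + k)) (z : Pinf.flow.Slice ⟨t, hI' i ht⟩),
        ∃ x : ∀ k, (S.P (i + k)).flow.Slice ⟨t, (S.ℭ.dom_subset (i + k)
            (S.hdom₁ (i + k) ⟨ht.1, fun h ↦ ht.2 (mem_iUnion.2 ⟨k, h⟩)⟩)).1⟩,
          Tendsto (fun k ↦ S.ℭ.φ (i + k) t
            (S.hdom₁ (i + k) ⟨ht.1, fun h ↦ ht.2 (mem_iUnion.2 ⟨k, h⟩)⟩) (x k)) atTop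
            (𝓝 (ι t (hI' i ht) z))) ∧
      (∀ i s (hs : s ∈ I₀ \ ⋃ k, S.E (i + k)) t (ht : t ∈ I₀ \ ⋃ k, S.E (i + k)), s ≤ t →
        ∀ (z : Pinf.flow.Slice ⟨t, hI' i ht⟩)
          (x : ∀ k, (S.P (i + k)).flow.Slice ⟨t, (S.ℭ.dom_subset (i + k)
            (S.hdom₁ (i + k) ⟨ht.1, fun h ↦ ht.2 (mem_iUnion.2 ⟨k, h⟩)⟩)).1⟩),
          Tendsto (fun k ↦ S.ℭ.φ (i + k) t
            (S.hdom₁ (i + k) ⟨ht.1, fun h ↦ ht.2 (mem_iUnion.2 ⟨k, h⟩)⟩) (x k)) atTop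
            (𝓝 (ι t (hI' i ht) z)) →
          Tendsto (fun k ↦ wassersteinW1 (X := S.ℭ.Z ⟨s, hs.1⟩)
            (((S.P (i + k)).flow.condKernel (x k) ⟨s, (S.ℭ.dom_subset (i + k)
                (S.hdom₁ (i + k) ⟨hs.1, fun h ↦ hs.2 (mem_iUnion.2 ⟨k, h⟩)⟩)).1⟩).map
              (S.ℭ.φ (i + k) s (S.hdom₁ (i + k) ⟨hs.1, fun h ↦ hs.2 (mem_iUnion.2 ⟨k, h⟩)⟩)))
            ((Pinf.flow.condKernel z ⟨s, hI' i hs⟩).map (ι s (hI' i hs)))) atTop (𝓝 0)) := by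
  refine ⟨S.limitPair, fun i ↦ S.G_subset_I' i, fun t ht ↦ Subtype.val,
    fun t ht ↦ isometry_subtype_coe, S.isHConcentrated_limitFlow, S.diff_I', ?_, ?_, ?_, ?_⟩
  · show MeasurableSet (I₀ \ S.I')
    rw [S.diff_I']
    exact S.measurableSet_N
  · intro i k t ht
    show wassersteinW1 (S.push (i + k) t (S.memDom ht k))
      ((supportMeasure (S.m t (S.G_subset_I' i ht))).map Subtype.val) < _
    rw [map_val_supportMeasure]
    refine (S.wassersteinW1_push_m_le (S.G_subset_I' i ht) (S.G_mono (Nat.le_add_right i k) ht)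
      _).trans_lt ((ENNReal.ofReal_lt_ofReal_iff (by positivity)).2 ?_)
    linarith [pow_pos (by norm_num : (0 : ℝ) < 2⁻¹) (i + k)]
  · intro i t ht z
    exact S.exists_seq_tendsto (S.G_subset_I' i ht) ht z.2
  · intro i s hs t ht hst z x hx
    show Tendsto (fun k ↦ wassersteinW1 (S.kpush (i + k) hs.1 (S.memDom hs k) (S.memDom ht k) (x k))
      ((S.kernel (S.G_subset_I' i ht) z (S.G_subset_I' i hs)).map Subtype.val)) atTop (𝓝 0)
    rw [S.map_val_kernel _ _ hst]
    exact S.tendsto_kpush_νZ (S.G_subset_I' i hs) (S.G_subset_I' i ht) hst z.2 hs ht x hx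

end ChainSetup

/-- **Bamler 2023, Lemma 5.20 (arXiv v1 Lemma 121), construction of the limit metric flow pair
within a correspondence along a fast chain.** Let `P n` be `H`-concentrated metric flow pairs over
`I₀`, `ℭ` a correspondence between all their flows over `I₀` with complete separable comparison
spaces `Z_t`, and `E n` exceptional sets with which the radius `2^{-n}` is admissible for
`d^{ℭ,J}_𝔽(P n, P (n+1))` (`FDistAdmissibleWith`), `I₀ ∖ E n ⊆ I''^{,n} ∩ I''^{,n+1}`. Then there is
a metric flow pair `P∞` over `I₀`, defined over `I'^{,∞} ⊇ I₀ ∖ ⋃ₖ E (i + k)` for every `i`, with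
isometric embeddings `ι_t : 𝒳^∞_t → Z_t`, `t ∈ I'^{,∞}`, such that: `𝒳^∞` is `H`-concentrated;
`I₀ ∖ I'^{,∞} = ⋂ᵢ ⋃ₖ E (i + k)` (a measurable null set); for `t ∈ I₀ ∖ ⋃ₖ E (i + k)`,
`d_{W₁}((φ^{i+k}_t)_* μ^{i+k}_t, (ι_t)_* μ^∞_t) < 4 · 2^{-(i+k)}`; every point of `𝒳^∞_t` is the
limit of images `φ^{i+k}_t(x_k)` of points `x_k ∈ 𝒳^{i+k}_t`; and along every such sequence, for
good `s ≤ t`, `(φ^{i+k}_s)_* ν^{i+k}_{x_k;s} → (ι_s)_* ν^∞_{z;s}` in `d_{W₁}` (Claim 5.21). Proof: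
the printed construction — `X^∞_t := supp μ^∞_t` for the `W₁`-limit `μ^∞_t` of `(φⁿ_t)_* μⁿ_t`, the
limit kernels of Claim 5.21, Claim 5.22 — assembled in `ChainSetup.limitPair`.
[cite: Bamler2023, §5.4, Lemma 5.20 (arXiv v1 Lemma 121), Claims 5.21–5.22] -/
theorem exists_limitPair_of_chain {I₀ : Set ℝ} {H : ℝ} (hH : 0 ≤ H)
    (P : ℕ → MetricFlowPair.{u} I₀) (hP : ∀ n, (P n).flow.IsHConcentrated H)
    (ℭ : FamilyCorrespondence (fun n ↦ (P n).flow) I₀)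
    (hZc : ∀ t, CompleteSpace (ℭ.Z t)) (hZs : ∀ t, SeparableSpace (ℭ.Z t))
    {J : Set ℝ} (E : ℕ → Set ℝ)
    (hE : ∀ n, FDistAdmissibleWith (P n) (P (n + 1)) (ℭ.pair n (n + 1)) (E n) J (2⁻¹ ^ n))
    (hdom₁ : ∀ n, I₀ \ E n ⊆ ℭ.dom n) (hdom₂ : ∀ n, I₀ \ E n ⊆ ℭ.dom (n + 1)) :
    ∃ (Pinf : MetricFlowPair.{u} I₀) (hI' : ∀ i, I₀ \ ⋃ k, E (i + k) ⊆ Pinf.I')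
      (ι : ∀ (t : ℝ) (ht : t ∈ Pinf.I'), Pinf.flow.Slice ⟨t, ht⟩ → ℭ.Z ⟨t, Pinf.subset ht⟩),
      (∀ t ht, Isometry (ι t ht)) ∧ Pinf.flow.IsHConcentrated H ∧
      I₀ \ Pinf.I' = ⋂ i, ⋃ k, E (i + k) ∧ MeasurableSet (I₀ \ Pinf.I') ∧
      -- `W₁`-convergence of the measures with an explicit rate
      (∀ i k t (ht : t ∈ I₀ \ ⋃ k, E (i + k)),
        wassersteinW1 (X := ℭ.Z ⟨t, ht.1⟩)
          (((P (i + k)).μ ⟨t, (ℭ.dom_subset (i + k)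
              (hdom₁ (i + k) ⟨ht.1, fun h ↦ ht.2 (mem_iUnion.2 ⟨k, h⟩)⟩)).1⟩).map
            (ℭ.φ (i + k) t (hdom₁ (i + k) ⟨ht.1, fun h ↦ ht.2 (mem_iUnion.2 ⟨k, h⟩)⟩)))
          ((Pinf.μ ⟨t, hI' i ht⟩).map (ι t (hI' i ht))) < ENNReal.ofReal (4 * 2⁻¹ ^ (i + k))) ∧
      -- every point of a limit slice is a limit of images of points
      (∀ i t (ht : t ∈ I₀ \ ⋃ k, E (i + k)) (z : Pinf.flow.Slice ⟨t, hI' i ht⟩),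
        ∃ x : ∀ k, (P (i + k)).flow.Slice ⟨t, (ℭ.dom_subset (i + k)
            (hdom₁ (i + k) ⟨ht.1, fun h ↦ ht.2 (mem_iUnion.2 ⟨k, h⟩)⟩)).1⟩,
          Tendsto (fun k ↦ ℭ.φ (i + k) t
            (hdom₁ (i + k) ⟨ht.1, fun h ↦ ht.2 (mem_iUnion.2 ⟨k, h⟩)⟩) (x k)) atTop
            (𝓝 (ι t (hI' i ht) z))) ∧
      -- convergence of the conjugate heat kernels along every such approximating sequence
      (∀ i s (hs : s ∈ I₀ \ ⋃ k, E (i + k)) t (ht : t ∈ I₀ \ ⋃ k, E (i + k)), s ≤ t →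
        ∀ (z : Pinf.flow.Slice ⟨t, hI' i ht⟩)
          (x : ∀ k, (P (i + k)).flow.Slice ⟨t, (ℭ.dom_subset (i + k)
            (hdom₁ (i + k) ⟨ht.1, fun h ↦ ht.2 (mem_iUnion.2 ⟨k, h⟩)⟩)).1⟩),
          Tendsto (fun k ↦ ℭ.φ (i + k) t
            (hdom₁ (i + k) ⟨ht.1, fun h ↦ ht.2 (mem_iUnion.2 ⟨k, h⟩)⟩) (x k)) atTop
            (𝓝 (ι t (hI' i ht) z)) →
          Tendsto (fun k ↦ wassersteinW1 (X := ℭ.Z ⟨s, hs.1⟩)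
            (((P (i + k)).flow.condKernel (x k) ⟨s, (ℭ.dom_subset (i + k)
                (hdom₁ (i + k) ⟨hs.1, fun h ↦ hs.2 (mem_iUnion.2 ⟨k, h⟩)⟩)).1⟩).map
              (ℭ.φ (i + k) s (hdom₁ (i + k) ⟨hs.1, fun h ↦ hs.2 (mem_iUnion.2 ⟨k, h⟩)⟩)))
            ((Pinf.flow.condKernel z ⟨s, hI' i hs⟩).map (ι s (hI' i hs)))) atTop (𝓝 0)) :=
  ChainSetup.exists_limitPair ⟨H, hH, P, hP, ℭ, hZc, hZs, J, E, hE, hdom₁, hdom₂⟩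

end MetricFlowPair

end Literature.Geometry.Riemannian

end
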